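import Mathlib
import Literature.RepresentationTheory.FiniteGroups.IrreducibleCharacters

/-!
# Stub `stub_wreathSep` — the graded Cohn–Kleinberg–Szegedy–Umans wreath step

Host `W := (ι → H) ⋊[mulAutArrow] Equiv.Perm ι`.  The wreath test space
`J_wr := span{w ↦ [w.right = τ₀] · Π_j g_j (w.left j) : τ₀ ∈ Perm ι, g_j ∈ J_H}` is bi-invariant,
and the lift `Â = (Π_j A_j) × Perm ι`, `B̂`, `Ĉ` of a simultaneously `J_H`-separated family
`(A_i, B_i, C_i)` is `J_wr`-separated. [cite: CohnKleinbergSzegedyUmans2005, Thm. 7.1]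
-/

noncomputable section

set_option linter.dupNamespace false

open scoped BigOperators
open Literature.RepresentationTheory.FiniteGroups

namespace Summit.MatrixMultiplication.MatrixMultiplication.Theorems.GradedDesignFamily

/-- Coordinates of the `Perm ι`-action on `ι → H` used by the wreath product:
`(mulAutArrow π k) j = k (π⁻¹ j)`. -/
theorem wreathSep_aut_apply {H : Type} [Group H] {ι : Type} (π : Equiv.Perm ι) (k : ι → H)
    (j : ι) : ((mulAutArrow π : MulAut (ι → H)) k) j = k (π⁻¹ j) := rfl

/-- Permutation part of a two-sided translate `a * w * b` in the wreath product. -/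
theorem wreathSep_conj_right {H : Type} [Group H] {ι : Type}
    (a w b : (ι → H) ⋊[mulAutArrow] Equiv.Perm ι) :
    (a * w * b).right = a.right * w.right * b.right := by
  simp only [SemidirectProduct.mul_right]

/-- Coordinates of a two-sided translate `a * w * b` in the wreath product. -/
theorem wreathSep_conj_left {H : Type} [Group H] {ι : Type}
    (a w b : (ι → H) ⋊[mulAutArrow] Equiv.Perm ι) (j : ι) :
    (a * w * b).left j = a.left j * w.left (a.right⁻¹ j) * b.left (w.right⁻¹ (a.right⁻¹ j)) := by
  simp only [SemidirectProduct.mul_left, SemidirectProduct.mul_right,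
    Pi.mul_apply, wreathSep_aut_apply, mul_inv_rev, Equiv.Perm.coe_mul, Function.comp_apply]

/-- Permutation part of the quadruple product `x⁻¹ * y * y'⁻¹ * z` in the wreath product. -/
theorem wreathSep_quad_right {H : Type} [Group H] {ι : Type}
    (x y y' z : (ι → H) ⋊[mulAutArrow] Equiv.Perm ι) :
    (x⁻¹ * y * y'⁻¹ * z).right = x.right⁻¹ * y.right * y'.right⁻¹ * z.right := by
  simp only [SemidirectProduct.mul_right, SemidirectProduct.inv_right]

/-- Coordinates of the quadruple product `x⁻¹ * y * y'⁻¹ * z` in the wreath product: coordinate `j`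
is a mixed quadruple product with `x`-part from piece `x.right j` and `z`-part from piece
`y'.right (y.right⁻¹ (x.right j))`. -/
theorem wreathSep_quad_left {H : Type} [Group H] {ι : Type}
    (x y y' z : (ι → H) ⋊[mulAutArrow] Equiv.Perm ι) (j : ι) :
    (x⁻¹ * y * y'⁻¹ * z).left j =
      (x.left (x.right j))⁻¹ * y.left (x.right j) *
        (y'.left (y'.right (y.right⁻¹ (x.right j))))⁻¹ *
          z.left (y'.right (y.right⁻¹ (x.right j))) := by
  simp only [SemidirectProduct.mul_left, SemidirectProduct.mul_right, SemidirectProduct.inv_left,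
    SemidirectProduct.inv_right, Pi.mul_apply, Pi.inv_apply, wreathSep_aut_apply, inv_inv,
    mul_inv_rev, Equiv.Perm.coe_mul, Function.comp_apply]

/-- Membership in a lifted set `(Π_j A_j) × Perm ι ⊆ (ι → H) ⋊ Perm ι` is coordinatewise
membership. -/
theorem wreathSep_mem_lift {H : Type} [Group H] {ι : Type} [Fintype ι] [DecidableEq ι]
    (A : ι → Finset H) (w : (ι → H) ⋊[mulAutArrow] Equiv.Perm ι) :
    w ∈ ((Fintype.piFinset A) ×ˢ (Finset.univ : Finset (Equiv.Perm ι))).map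
        (SemidirectProduct.equivProd.symm.toEmbedding) ↔ ∀ j, w.left j ∈ A j := by
  rw [Finset.mem_map_equiv, Equiv.symm_symm, SemidirectProduct.equivProd_apply,
    Finset.mem_product, Fintype.mem_piFinset]
  simp only [Finset.mem_univ, and_true]

/-- A two-sided translate of a generator `w ↦ [w.right = τ₀] · Π_j g_j (w.left j)` of the wreath
test space is again such a generator (with permuted and two-sided translated factors
`g'_j ∈ J_H`). -/
theorem wreathSep_gen {H : Type} [Group H] {ι : Type} [Fintype ι] [DecidableEq ι]
    (JH : Submodule ℂ (H → ℂ)) (hJH : ∀ f ∈ JH, ∀ a b : H, (fun g : H => f (a * g * b)) ∈ JH)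
    (τ₀ : Equiv.Perm ι) (g : ι → (H → ℂ)) (hg : ∀ j, g j ∈ JH)
    (a b : (ι → H) ⋊[mulAutArrow] Equiv.Perm ι) :
    ∃ (τ₁ : Equiv.Perm ι) (g' : ι → (H → ℂ)), (∀ j, g' j ∈ JH) ∧
      (fun w : (ι → H) ⋊[mulAutArrow] Equiv.Perm ι =>
          if (a * w * b).right = τ₀ then ∏ j, g j ((a * w * b).left j) else (0 : ℂ)) =
        fun w => if w.right = τ₁ then ∏ j, g' j (w.left j) else 0 := by
  refine ⟨a.right⁻¹ * τ₀ * b.right⁻¹,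
    fun i h => g (a.right i) (a.left (a.right i) * h * b.left (b.right (τ₀⁻¹ (a.right i)))),
    fun i => hJH _ (hg (a.right i)) _ _, ?_⟩
  funext w
  by_cases hw : w.right = a.right⁻¹ * τ₀ * b.right⁻¹
  · have h1 : (a * w * b).right = τ₀ := by
      rw [wreathSep_conj_right, hw]; group
    rw [if_pos h1, if_pos hw]
    have h2 : ∀ j, w.right⁻¹ (a.right⁻¹ j) = b.right (τ₀⁻¹ j) := by
      intro j
      rw [hw]
      simp only [mul_inv_rev, inv_inv, Equiv.Perm.coe_mul, Function.comp_apply,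
        Equiv.Perm.coe_inv, Equiv.apply_symm_apply]
    simp only [wreathSep_conj_left, h2]
    exact Fintype.prod_equiv a.right⁻¹ _ _ (fun j => by
      simp only [Equiv.Perm.coe_inv, Equiv.apply_symm_apply])
  · have h1 : ¬ (a * w * b).right = τ₀ := by
      intro h
      apply hw
      rw [wreathSep_conj_right] at h
      rw [← h]; group
    rw [if_neg h1, if_neg hw]

/-- Separation of the lifted triple: the separator of the target `(x₀, z₀) = (⟨kx₀, π₀⟩, ⟨kz₀, σ₀⟩)`
is the generator `w ↦ [w.right = π₀⁻¹σ₀] · Π_j f_{π₀ j} (w.left j)`, `f_i ∈ J_H` the simultaneous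
separator of the target `(kx₀ i, kz₀ i)` of piece `i`.
[cite: CohnKleinbergSzegedyUmans2005, Thm. 7.1] -/
theorem wreathSep_sep {H : Type} [Group H] [DecidableEq H] {ι : Type} [Fintype ι] [DecidableEq ι]
    (JH : Submodule ℂ (H → ℂ)) (A B C : ι → Finset H)
    (hsep : ∀ i : ι, ∀ x₀ ∈ A i, ∀ z₀ ∈ C i, ∃ f ∈ JH, ∀ a b : ι, ∀ x ∈ A a, ∀ y ∈ B a, ∀ y' ∈ B b,
      ∀ z ∈ C b, ((a = i ∧ b = i ∧ x = x₀ ∧ y = y' ∧ z = z₀) → f (x⁻¹ * y * y'⁻¹ * z) = 1) ∧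
        (¬ (a = i ∧ b = i ∧ x = x₀ ∧ y = y' ∧ z = z₀) → f (x⁻¹ * y * y'⁻¹ * z) = 0))
    (x₀ z₀ : (ι → H) ⋊[mulAutArrow] Equiv.Perm ι) (hx₀ : ∀ j, x₀.left j ∈ A j)
    (hz₀ : ∀ j, z₀.left j ∈ C j) :
    ∃ F ∈ Submodule.span ℂ {F : ((ι → H) ⋊[mulAutArrow] Equiv.Perm ι) → ℂ |
        ∃ (τ₀ : Equiv.Perm ι) (g : ι → (H → ℂ)), (∀ j, g j ∈ JH) ∧
          F = fun w => if w.right = τ₀ then ∏ j, g j (w.left j) else 0},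
      ∀ x y y' z : (ι → H) ⋊[mulAutArrow] Equiv.Perm ι, (∀ j, x.left j ∈ A j) →
        (∀ j, y.left j ∈ B j) → (∀ j, y'.left j ∈ B j) → (∀ j, z.left j ∈ C j) →
        ((x = x₀ ∧ y = y' ∧ z = z₀) → F (x⁻¹ * y * y'⁻¹ * z) = 1) ∧
        (¬ (x = x₀ ∧ y = y' ∧ z = z₀) → F (x⁻¹ * y * y'⁻¹ * z) = 0) := by
  choose f hfJ hf using fun i => hsep i (x₀.left i) (hx₀ i) (z₀.left i) (hz₀ i)
  refine ⟨fun w => if w.right = x₀.right⁻¹ * z₀.right then ∏ j, f (x₀.right j) (w.left j) else 0,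
    Submodule.subset_span ⟨x₀.right⁻¹ * z₀.right, fun j => f (x₀.right j), fun j => hfJ _, rfl⟩,
    ?_⟩
  intro x y y' z hx hy hy' hz
  -- each factor of the separator at the quadruple product is a simultaneous separator value
  have hfac : ∀ j, f (x₀.right j) ((x⁻¹ * y * y'⁻¹ * z).left j) =
      if (x.right j = x₀.right j ∧ y'.right (y.right⁻¹ (x.right j)) = x₀.right j ∧
          x.left (x.right j) = x₀.left (x₀.right j) ∧
          y.left (x.right j) = y'.left (y'.right (y.right⁻¹ (x.right j))) ∧
          z.left (y'.right (y.right⁻¹ (x.right j))) = z₀.left (x₀.right j)) then 1 else 0 := by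
    intro j
    rw [wreathSep_quad_left]
    obtain ⟨h1, h2⟩ := hf (x₀.right j) (x.right j) (y'.right (y.right⁻¹ (x.right j))) _ (hx _)
      _ (hy _) _ (hy' _) _ (hz _)
    split_ifs with hc
    · exact h1 hc
    · exact h2 hc
  have hval : (if (x⁻¹ * y * y'⁻¹ * z).right = x₀.right⁻¹ * z₀.right then
      ∏ j, f (x₀.right j) ((x⁻¹ * y * y'⁻¹ * z).left j) else (0 : ℂ)) =
      if (x = x₀ ∧ y = y' ∧ z = z₀) then 1 else 0 := by
    rw [wreathSep_quad_right]
    simp only [hfac, Fintype.prod_boole]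
    by_cases hxyz : x = x₀ ∧ y = y' ∧ z = z₀
    · obtain ⟨rfl, rfl, rfl⟩ := hxyz
      simp
    · rw [if_neg hxyz]
      split_ifs with hr hall
      · exfalso
        apply hxyz
        have hπ : x.right = x₀.right := Equiv.ext fun j => (hall j).1
        rw [hπ] at hall hr
        have hρ : y'.right = y.right :=
          Equiv.ext fun i => by simpa using (hall (x₀.right⁻¹ (y.right i))).2.1
        rw [hρ] at hall hr
        have hkx : x.left = x₀.left := funext fun i => by simpa using (hall (x₀.right⁻¹ i)).2.2.1
        have hky : y.left = y'.left := funext fun i => by simpa using (hall (x₀.right⁻¹ i)).2.2.2.1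
        have hkz : z.left = z₀.left := funext fun i => by simpa using (hall (x₀.right⁻¹ i)).2.2.2.2
        have hσ : z.right = z₀.right := by simpa using hr
        exact ⟨SemidirectProduct.ext hkx hπ, SemidirectProduct.ext hky hρ.symm,
          SemidirectProduct.ext hkz hσ⟩
      · rfl
      · rfl
  exact ⟨fun h => hval.trans (if_pos h), fun h => hval.trans (if_neg h)⟩

/-- **The graded CKSU wreath step.**  In `W := (ι → H) ⋊ Perm ι` the wreath test space
`J_wr = span{w ↦ [w.right = τ₀] · Π_j g_j (w.left j) : τ₀ ∈ Perm ι, g_j ∈ J_H}` is bi-invariant, and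
the lift `Â = (Π_j A_j) × Perm ι`, `B̂`, `Ĉ` of a simultaneously `J_H`-separated family is
`J_wr`-separated. [cite: CohnKleinbergSzegedyUmans2005, Thm. 7.1] -/
theorem stub_wreathSep {H : Type} [Group H] [DecidableEq H] {ι : Type} [Fintype ι] [DecidableEq ι]
    (JH : Submodule ℂ (H → ℂ)) (hJH : ∀ f ∈ JH, ∀ a b : H, (fun g : H => f (a * g * b)) ∈ JH)
    (A B C : ι → Finset H)
    (hsep : ∀ i : ι, ∀ x₀ ∈ A i, ∀ z₀ ∈ C i, ∃ f ∈ JH, ∀ a b : ι, ∀ x ∈ A a, ∀ y ∈ B a, ∀ y' ∈ B b,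
      ∀ z ∈ C b, ((a = i ∧ b = i ∧ x = x₀ ∧ y = y' ∧ z = z₀) → f (x⁻¹ * y * y'⁻¹ * z) = 1) ∧
        (¬ (a = i ∧ b = i ∧ x = x₀ ∧ y = y' ∧ z = z₀) → f (x⁻¹ * y * y'⁻¹ * z) = 0)) :
    (∀ F ∈ Submodule.span ℂ {F : ((ι → H) ⋊[mulAutArrow] Equiv.Perm ι) → ℂ |
        ∃ (τ₀ : Equiv.Perm ι) (g : ι → (H → ℂ)), (∀ j, g j ∈ JH) ∧
          F = fun w => if w.right = τ₀ then ∏ j, g j (w.left j) else 0},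
      ∀ a b : (ι → H) ⋊[mulAutArrow] Equiv.Perm ι,
        (fun w : (ι → H) ⋊[mulAutArrow] Equiv.Perm ι => F (a * w * b)) ∈
          Submodule.span ℂ {F : ((ι → H) ⋊[mulAutArrow] Equiv.Perm ι) → ℂ |
            ∃ (τ₀ : Equiv.Perm ι) (g : ι → (H → ℂ)), (∀ j, g j ∈ JH) ∧
              F = fun w => if w.right = τ₀ then ∏ j, g j (w.left j) else 0}) ∧
    (∀ x₀ ∈ ((Fintype.piFinset A) ×ˢ (Finset.univ : Finset (Equiv.Perm ι))).map
        (SemidirectProduct.equivProd.symm.toEmbedding),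
      ∀ z₀ ∈ ((Fintype.piFinset C) ×ˢ (Finset.univ : Finset (Equiv.Perm ι))).map
        (SemidirectProduct.equivProd.symm.toEmbedding),
      ∃ F ∈ Submodule.span ℂ {F : ((ι → H) ⋊[mulAutArrow] Equiv.Perm ι) → ℂ |
        ∃ (τ₀ : Equiv.Perm ι) (g : ι → (H → ℂ)), (∀ j, g j ∈ JH) ∧
          F = fun w => if w.right = τ₀ then ∏ j, g j (w.left j) else 0},
      ∀ x ∈ ((Fintype.piFinset A) ×ˢ (Finset.univ : Finset (Equiv.Perm ι))).map
          (SemidirectProduct.equivProd.symm.toEmbedding),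
      ∀ y ∈ ((Fintype.piFinset B) ×ˢ (Finset.univ : Finset (Equiv.Perm ι))).map
          (SemidirectProduct.equivProd.symm.toEmbedding),
      ∀ y' ∈ ((Fintype.piFinset B) ×ˢ (Finset.univ : Finset (Equiv.Perm ι))).map
          (SemidirectProduct.equivProd.symm.toEmbedding),
      ∀ z ∈ ((Fintype.piFinset C) ×ˢ (Finset.univ : Finset (Equiv.Perm ι))).map
          (SemidirectProduct.equivProd.symm.toEmbedding),
        ((x = x₀ ∧ y = y' ∧ z = z₀) → F (x⁻¹ * y * y'⁻¹ * z) = 1) ∧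
        (¬ (x = x₀ ∧ y = y' ∧ z = z₀) → F (x⁻¹ * y * y'⁻¹ * z) = 0)) := by
  refine ⟨?_, ?_⟩
  · intro F hF a b
    have key : Submodule.span ℂ {F : ((ι → H) ⋊[mulAutArrow] Equiv.Perm ι) → ℂ |
        ∃ (τ₀ : Equiv.Perm ι) (g : ι → (H → ℂ)), (∀ j, g j ∈ JH) ∧
          F = fun w => if w.right = τ₀ then ∏ j, g j (w.left j) else 0} ≤
        (Submodule.span ℂ {F : ((ι → H) ⋊[mulAutArrow] Equiv.Perm ι) → ℂ |
          ∃ (τ₀ : Equiv.Perm ι) (g : ι → (H → ℂ)), (∀ j, g j ∈ JH) ∧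
            F = fun w => if w.right = τ₀ then ∏ j, g j (w.left j) else 0}).comap
          (LinearMap.funLeft ℂ ℂ fun w : (ι → H) ⋊[mulAutArrow] Equiv.Perm ι => a * w * b) := by
      refine Submodule.span_le.mpr ?_
      rintro _ ⟨τ₀, g, hg, rfl⟩
      obtain ⟨τ₁, g', hg', h⟩ := wreathSep_gen JH hJH τ₀ g hg a b
      refine Submodule.subset_span ⟨τ₁, g', hg', ?_⟩
      rw [← h]
      rfl
    exact key hF
  · intro x₀ hx₀ z₀ hz₀
    rw [wreathSep_mem_lift] at hx₀ hz₀
    obtain ⟨F, hF, hFsep⟩ := wreathSep_sep JH A B C hsep x₀ z₀ hx₀ hz₀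
    refine ⟨F, hF, ?_⟩
    intro x hx y hy y' hy' z hz
    rw [wreathSep_mem_lift] at hx hy hy' hz
    exact hFsep x y y' z hx hy hy' hz

end Summit.MatrixMultiplication.MatrixMultiplication.Theorems.GradedDesignFamily

end
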